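import Literature.AlgebraicGeometry.HodgeTheory.UnitaryHodgeGroupOfRibetTypeTwoThree
import HarnessLib

/-!
# The unitary factor inputs in ADMISSIBLE form, read on `H¹(A)`: for `A` of Ribet type `(m,1)` (`m ≥ 2`) or `(2,3)` with `End⁰ = k`, EVERY bracket-closed rational `𝔤 ⊆ End_ℚ H¹(A;ℚ)` commuting with `End_Hdg`, `ψ`-skew and with the Hodge operator in its complex span contains `𝔲_k(H¹A, ψ) ⊗ ℂ` (Ribet 1983 Thm. 3; Moonen–Zarhin 1999 (2.3)–(2.4), (2.7); Deligne I §3)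

Family `hodge`, layer `Literature/AlgebraicGeometry/HodgeTheory`; cell `pub-hodgeav-hg6` (TABLE X Weil PRODUCT rows 17 ∕ 20 ∕ 22:
the FACTOR input `hLie₁` of the product brick `Motives/HodgeLieUnitaryTimesCMCurveSU` (K1) in the shape that brick consumes;
nothing here proves HC, HC_AV or HC_CM).  UNCONDITIONAL; theorems only, no definition, no named fact, no instance, no `sorry`.

WHY THIS FILE.  The tree's AV adapters `hodgeLieC_typeOne_of_eigenMultiplicity_eq_one` (`UnitaryHodgeGroupOfRibetTypeOne`) and
`hodgeLieC_twoThree_of_dim_eq_five` (`UnitaryHodgeGroupOfRibetTypeTwoThree`) conclude membership in `Lie Hg(H¹A) ⊗ ℂ`, i.e.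
they apply the HS cores `UnitaryTheta.mem_spanC_of_commute_of_skew` ∕ `UnitaryThetaTwoThree.mem_spanC_of_commute_of_skew` to
`𝔤 = Lie Hg`.  The product brick of rows 17 ∕ 20 ∕ 22 needs the cores' NATIVE form at the factor: for EVERY admissible `𝔤₁`
(bracket-closed, commuting with `End_Hdg(H¹Y)`, `ψ₁`-skew, `Θ₁ ∈ spanC 𝔤₁`) — because the corner algebra `π₁ 𝔥(H) ι₁` of a
product `H = H¹(Y × C)` is such a `𝔤₁` and may a priori be smaller than `Lie Hg(H¹Y)`.  This file is the 40-line AV→HS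
dictionary (`unop_bettiRep_mem_endAlg`, `bettiMapHom_mul_self`, `exists_eq_smul_one_add_smul_bettiMapHom`,
`finrank_eigenspace_inf_piece_{oneZero,zeroOne}_eq_eigenMultiplicity{,_conj}`) in front of the cores, once, for every row:
* §1 **`mem_spanC_typeOne_of_eigenMultiplicity_eq_one`** — Ribet type `(dim A − 1, 1)`: `φ ≫ φ = -d`, `d > 0`,
  `finrank_ℚ End⁰(A) = 2`, multiplicity `1` at `i√d` or at `−i√d`, `dim A ≥ 3` (rows 19 ∕ 22: `Y₃`, `(2,1)`; row 20: `Y₄`, `(3,1)`);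
* §2 **`mem_spanC_twoThree_of_eigenMultiplicity`**, **`mem_spanC_twoThree_of_dim_eq_five`** — Ribet type `(2,3)` (row 17: `Y₅`,
  `(3,2)`).
In each: for every admissible `𝔤 ⊆ End_ℚ H¹(A(ℂ); ℚ)` and ANY polarization `ψ` of `H¹(A)`, every `(φ^*)_ℂ`-commuting
`ψ_ℂ`-skew operator lies in `spanC 𝔤`.

## References
* [Ribet1983] K. A. Ribet, Amer. J. Math. 105 (1983), Thm. 3.
* [MoonenZarhin1999LowDim] B. Moonen, Yu. Zarhin, Math. Ann. 315 (1999), §2 (2.3)–(2.4), Thm. (2.7), §3 (3.1).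
* [Deligne1982HodgeCycles] P. Deligne, LNM 900 (1982), I §3 Prop. 3.4 (and its proof).
* [Gordon1997] B. B. Gordon, arXiv:alg-geom/9709030, Thm. 6.3 (3), §6 pp. 18–19.
-/

noncomputable section

open scoped TensorProduct
open CategoryTheory Module

namespace Literature.AlgebraicGeometry.HodgeTheory

open Literature.AlgebraicTopology.SingularHomology
open Literature.AlgebraicGeometry.Motives (IsSmoothProjective AbelianVariety bettiCohomology
  ofRatClassBaseChange ofRatClassBaseChange_tmul HodgeTensorFacts hodgeTensorFacts_holds)
open Literature.Barriers.HodgeConjecture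
open Literature.AlgebraicGeometry.Motives.HodgeStructure
open Literature.AlgebraicGeometry.ComplexMultiplication (bettiRep_of)

variable {A : AbelianVariety ℂ}

/-! ## §1 Ribet type `(m,1)`, admissible form -/

/-- **Ribet type `(dim A − 1, 1)`, ADMISSIBLE form on `H¹(A)`** (`φ ≫ φ = -d`, `d > 0`, `finrank_ℚ End⁰(A) = 2`, multiplicity
`1` at `i√d` or at `−i√d`, `dim A ≥ 3`): for EVERY bracket-closed rational `𝔤 ⊆ End_ℚ H¹(A(ℂ); ℚ)` commuting with the Hodge
endomorphisms, `ψ`-skew, whose complex span contains an operator `Θ` acting by `2p − 1` on `H^{p,1−p}`, every `(φ^*)_ℂ`-commuting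
`ψ_ℂ`-skew operator lies in `spanC 𝔤` — the tree's HS core `UnitaryTheta.mem_spanC_of_commute_of_skew` behind the multiplicity
dictionary of `hodgeLieC_typeOne_of_eigenMultiplicity_eq_one` (that theorem is the case `𝔤 = Lie Hg`).  Rows 19 ∕ 22 (`Y₃`, `(2,1)`)
and 20 (`Y₄`, `(3,1)`) of TABLE X quote their unitary factor in this shape.
[cite: Ribet1983, Thm. 3] [cite: MoonenZarhin1999LowDim, §2 (2.3) and §3 (3.1)] [cite: Deligne1982HodgeCycles, I §3 Prop. 3.4] -/
theorem mem_spanC_typeOne_of_eigenMultiplicity_eq_one (φ : A ⟶ A) {d : ℕ} (hd : 0 < d)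
    (hφ : φ ≫ φ = -(d • 𝟙 A)) (hE2 : Module.finrank ℚ A.endAlgebra = 2)
    (h1 : eigenMultiplicity A φ (Complex.I * (Real.sqrt d : ℂ)) = 1 ∨
      eigenMultiplicity A φ (-(Complex.I * (Real.sqrt d : ℂ))) = 1)
    (hdim : 3 ≤ A.dim) (hHD : exists_isReal_hodgeModel) (hI : hodgePQ_independent_of_hodgeModel)
    (ψ : (BettiUniverse.hodge hHD (AbelianVariety.isSmoothProjective_holds (A := A)) 1).Polarization)
    (𝔤 : Submodule ℚ (Module.End ℚ (bettiCohomology A.X 1))) (hbr : ∀ X ∈ 𝔤, ∀ X' ∈ 𝔤, X * X' - X' * X ∈ 𝔤)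
    {Θ : Module.End ℂ (ℂ ⊗[ℚ] bettiCohomology A.X 1)}
    (hΘ : ∀ p : ℤ, ∀ x ∈ (BettiUniverse.hodge hHD (AbelianVariety.isSmoothProjective_holds (A := A)) 1).piece p (1 - p),
      Θ x = ((2 * p - 1 : ℤ) : ℂ) • x)
    (hΘ𝔤 : Θ ∈ spanC 𝔤)
    (hcomm : ∀ X ∈ 𝔤, ∀ a : (BettiUniverse.hodge hHD (AbelianVariety.isSmoothProjective_holds (A := A)) 1).endAlg,
      X * (a : Module.End ℚ (bettiCohomology A.X 1)) = (a : Module.End ℚ (bettiCohomology A.X 1)) * X)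
    (hskew : ∀ X ∈ 𝔤, ∀ v w, ψ.form (X v) w + ψ.form v (X w) = 0) :
    ∀ Y : Module.End ℂ (ℂ ⊗[ℚ] bettiCohomology A.X 1),
      Y * ((bettiCohomology.map φ.hom.hom.hom 1).hom).baseChange ℂ =
          ((bettiCohomology.map φ.hom.hom.hom 1).hom).baseChange ℂ * Y →
        (∀ x y, ψ.form.baseChange ℂ (Y x) y + ψ.form.baseChange ℂ x (Y y) = 0) → Y ∈ spanC 𝔤 := by
  classical
  intro Y hYφ hYskew
  haveI : Module.Finite ℚ (bettiCohomology A.X 1) := finite_bettiCohomology_one A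
  have heff := BettiUniverse.hodge_isEffective hHD (AbelianVariety.isSmoothProjective_holds (A := A)) 1
  set φQ : Module.End ℚ (bettiCohomology A.X 1) := (bettiCohomology.map φ.hom.hom.hom 1).hom with hφQ
  have hφE : φQ ∈ (BettiUniverse.hodge hHD (AbelianVariety.isSmoothProjective_holds (A := A)) 1).endAlg := by
    have h := unop_bettiRep_mem_endAlg hHD hI (AbelianVariety.endAlgebra.of A φ)
    rwa [bettiRep_of, MulOpposite.unop_op] at h
  have hφ2 : φQ * φQ = -((d : ℚ) • 1) := bettiMapHom_mul_self hφ
  have hdQ : (0 : ℚ) < d := Nat.cast_pos.2 hd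
  have hE := exists_eq_smul_one_add_smul_bettiMapHom hHD hI hd hφ hE2 (by omega)
  -- the eigenvalue `μ` with `n''(μ) = 1`, `n'(μ) ≥ 2`
  have hsum := eigenMultiplicity_add_eigenMultiplicity_neg_eq_dim A φ hd hφ
  have hμ₀ : (Complex.I * (Real.sqrt d : ℂ)) ^ 2 = -((d : ℚ) : ℂ) := by
    rw [mul_pow, Complex.I_sq, ← Complex.ofReal_pow, Real.sq_sqrt (Nat.cast_nonneg d), Complex.ofReal_natCast,
      Rat.cast_natCast, neg_one_mul]
  have hconj₀ : starRingEnd ℂ (Complex.I * (Real.sqrt d : ℂ)) = -(Complex.I * (Real.sqrt d : ℂ)) := by simp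
  obtain ⟨μ, hμ, hm1, hm2⟩ : ∃ μ : ℂ, μ ^ 2 = -((d : ℚ) : ℂ) ∧
      eigenMultiplicity A φ (starRingEnd ℂ μ) = 1 ∧ 2 ≤ eigenMultiplicity A φ μ := by
    rcases h1 with h | h
    · exact ⟨-(Complex.I * (Real.sqrt d : ℂ)), by rw [neg_sq, hμ₀], by rw [map_neg, hconj₀, neg_neg, h], by omega⟩
    · exact ⟨Complex.I * (Real.sqrt d : ℂ), hμ₀, by rw [hconj₀, h], by omega⟩
  have h1' : Module.finrank ℂ ↥(Module.End.eigenspace (φQ.baseChange ℂ) μ ⊓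
      (BettiUniverse.hodge hHD (AbelianVariety.isSmoothProjective_holds (A := A)) 1).piece 0 1) = 1 := by
    rw [hφQ, finrank_eigenspace_inf_piece_zeroOne_eq_eigenMultiplicity_conj hHD hI φ μ, hm1]
  have h2' : 2 ≤ Module.finrank ℂ ↥(Module.End.eigenspace (φQ.baseChange ℂ) μ ⊓
      (BettiUniverse.hodge hHD (AbelianVariety.isSmoothProjective_holds (A := A)) 1).piece 1 0) := by
    rw [hφQ, finrank_eigenspace_inf_piece_oneZero_eq_eigenMultiplicity hHD hI φ μ]; exact hm2
  exact UnitaryTheta.mem_spanC_of_commute_of_skew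
    (BettiUniverse.hodge hHD (AbelianVariety.isSmoothProjective_holds (A := A)) 1) Nat.cast_one heff ψ hφE hdQ hφ2 hE
    hμ h1' h2' 𝔤 hbr hΘ hΘ𝔤 hcomm hskew hYφ hYskew

/-! ## §2 Ribet type `(2,3)`, admissible form -/

/-- **Ribet type `(2,3)`, ADMISSIBLE form on `H¹(A)`** (`φ ≫ φ = -d`, `d > 0`, `finrank_ℚ End⁰(A) = 2`, eigen-multiplicities
`{3,2}` at `± i√d`, so `dim A = 5`): for EVERY bracket-closed rational `𝔤 ⊆ End_ℚ H¹(A(ℂ); ℚ)` commuting with the Hodge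
endomorphisms, `ψ`-skew, whose complex span contains the Hodge operator, every `(φ^*)_ℂ`-commuting `ψ_ℂ`-skew operator lies
in `spanC 𝔤` — the tree's core `UnitaryThetaTwoThree.mem_spanC_of_commute_of_skew` behind the dictionary of
`hodgeLieC_twoThree_of_eigenMultiplicity`.  Row 17 (`Y₅`, `(3,2)`) of TABLE X quotes its unitary factor in this shape.
[cite: MoonenZarhin1999LowDim, §2 (2.4) and Thm. (2.7)] [cite: Ribet1983, Thm. 3] [cite: Deligne1982HodgeCycles, I §3 Prop. 3.4] -/
theorem mem_spanC_twoThree_of_eigenMultiplicity (φ : A ⟶ A) {d : ℕ} (hd : 0 < d)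
    (hφ : φ ≫ φ = -(d • 𝟙 A)) (hE2 : Module.finrank ℚ A.endAlgebra = 2)
    (h23 : (eigenMultiplicity A φ (Complex.I * (Real.sqrt d : ℂ)) = 3 ∧
        eigenMultiplicity A φ (-(Complex.I * (Real.sqrt d : ℂ))) = 2) ∨
      (eigenMultiplicity A φ (Complex.I * (Real.sqrt d : ℂ)) = 2 ∧
        eigenMultiplicity A φ (-(Complex.I * (Real.sqrt d : ℂ))) = 3))
    (hHD : exists_isReal_hodgeModel) (hI : hodgePQ_independent_of_hodgeModel)
    (ψ : (BettiUniverse.hodge hHD (AbelianVariety.isSmoothProjective_holds (A := A)) 1).Polarization)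
    (𝔤 : Submodule ℚ (Module.End ℚ (bettiCohomology A.X 1))) (hbr : ∀ X ∈ 𝔤, ∀ X' ∈ 𝔤, X * X' - X' * X ∈ 𝔤)
    {Θ : Module.End ℂ (ℂ ⊗[ℚ] bettiCohomology A.X 1)}
    (hΘ : ∀ p : ℤ, ∀ x ∈ (BettiUniverse.hodge hHD (AbelianVariety.isSmoothProjective_holds (A := A)) 1).piece p (1 - p),
      Θ x = ((2 * p - 1 : ℤ) : ℂ) • x)
    (hΘ𝔤 : Θ ∈ spanC 𝔤)
    (hcomm : ∀ X ∈ 𝔤, ∀ a : (BettiUniverse.hodge hHD (AbelianVariety.isSmoothProjective_holds (A := A)) 1).endAlg,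
      X * (a : Module.End ℚ (bettiCohomology A.X 1)) = (a : Module.End ℚ (bettiCohomology A.X 1)) * X)
    (hskew : ∀ X ∈ 𝔤, ∀ v w, ψ.form (X v) w + ψ.form v (X w) = 0) :
    ∀ Y : Module.End ℂ (ℂ ⊗[ℚ] bettiCohomology A.X 1),
      Y * ((bettiCohomology.map φ.hom.hom.hom 1).hom).baseChange ℂ =
          ((bettiCohomology.map φ.hom.hom.hom 1).hom).baseChange ℂ * Y →
        (∀ x y, ψ.form.baseChange ℂ (Y x) y + ψ.form.baseChange ℂ x (Y y) = 0) → Y ∈ spanC 𝔤 := by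
  classical
  intro Y hYφ hYskew
  haveI : Module.Finite ℚ (bettiCohomology A.X 1) := finite_bettiCohomology_one A
  have heff := BettiUniverse.hodge_isEffective hHD (AbelianVariety.isSmoothProjective_holds (A := A)) 1
  set φQ : Module.End ℚ (bettiCohomology A.X 1) := (bettiCohomology.map φ.hom.hom.hom 1).hom with hφQ
  have hφE : φQ ∈ (BettiUniverse.hodge hHD (AbelianVariety.isSmoothProjective_holds (A := A)) 1).endAlg := by
    have h := unop_bettiRep_mem_endAlg hHD hI (AbelianVariety.endAlgebra.of A φ)
    rwa [bettiRep_of, MulOpposite.unop_op] at h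
  have hφ2 : φQ * φQ = -((d : ℚ) • 1) := bettiMapHom_mul_self hφ
  have hdQ : (0 : ℚ) < d := Nat.cast_pos.2 hd
  have hsum := eigenMultiplicity_add_eigenMultiplicity_neg_eq_dim A φ hd hφ
  have hA : 0 < A.dim := by rcases h23 with ⟨h3, h2⟩ | ⟨h2, h3⟩ <;> omega
  have hE := exists_eq_smul_one_add_smul_bettiMapHom hHD hI hd hφ hE2 hA
  have hμ₀ : (Complex.I * (Real.sqrt d : ℂ)) ^ 2 = -((d : ℚ) : ℂ) := by
    rw [mul_pow, Complex.I_sq, ← Complex.ofReal_pow, Real.sq_sqrt (Nat.cast_nonneg d), Complex.ofReal_natCast,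
      Rat.cast_natCast, neg_one_mul]
  have hconj₀ : starRingEnd ℂ (Complex.I * (Real.sqrt d : ℂ)) = -(Complex.I * (Real.sqrt d : ℂ)) := by simp
  have h10 : Module.finrank ℂ ↥(Module.End.eigenspace (φQ.baseChange ℂ) (Complex.I * (Real.sqrt d : ℂ)) ⊓
      (BettiUniverse.hodge hHD (AbelianVariety.isSmoothProjective_holds (A := A)) 1).piece 1 0) =
      eigenMultiplicity A φ (Complex.I * (Real.sqrt d : ℂ)) := by
    rw [hφQ, finrank_eigenspace_inf_piece_oneZero_eq_eigenMultiplicity hHD hI φ]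
  have h01 : Module.finrank ℂ ↥(Module.End.eigenspace (φQ.baseChange ℂ) (Complex.I * (Real.sqrt d : ℂ)) ⊓
      (BettiUniverse.hodge hHD (AbelianVariety.isSmoothProjective_holds (A := A)) 1).piece 0 1) =
      eigenMultiplicity A φ (-(Complex.I * (Real.sqrt d : ℂ))) := by
    rw [hφQ, finrank_eigenspace_inf_piece_zeroOne_eq_eigenMultiplicity_conj hHD hI φ, hconj₀]
  have h23' : (Module.finrank ℂ ↥(Module.End.eigenspace (φQ.baseChange ℂ) (Complex.I * (Real.sqrt d : ℂ)) ⊓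
        (BettiUniverse.hodge hHD (AbelianVariety.isSmoothProjective_holds (A := A)) 1).piece 1 0) = 2 ∧
      Module.finrank ℂ ↥(Module.End.eigenspace (φQ.baseChange ℂ) (Complex.I * (Real.sqrt d : ℂ)) ⊓
        (BettiUniverse.hodge hHD (AbelianVariety.isSmoothProjective_holds (A := A)) 1).piece 0 1) = 3) ∨
      (Module.finrank ℂ ↥(Module.End.eigenspace (φQ.baseChange ℂ) (Complex.I * (Real.sqrt d : ℂ)) ⊓
        (BettiUniverse.hodge hHD (AbelianVariety.isSmoothProjective_holds (A := A)) 1).piece 1 0) = 3 ∧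
      Module.finrank ℂ ↥(Module.End.eigenspace (φQ.baseChange ℂ) (Complex.I * (Real.sqrt d : ℂ)) ⊓
        (BettiUniverse.hodge hHD (AbelianVariety.isSmoothProjective_holds (A := A)) 1).piece 0 1) = 2) := by
    rw [h10, h01]
    rcases h23 with ⟨h3, h2⟩ | ⟨h2, h3⟩
    · exact Or.inr ⟨h3, h2⟩
    · exact Or.inl ⟨h2, h3⟩
  exact UnitaryThetaTwoThree.mem_spanC_of_commute_of_skew
    (BettiUniverse.hodge hHD (AbelianVariety.isSmoothProjective_holds (A := A)) 1) Nat.cast_one heff ψ hφE hdQ hφ2 hE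
    hμ₀ h23' 𝔤 hbr hΘ hΘ𝔤 hcomm hskew hYφ hYskew

/-- **Convenience form for a FIVEFOLD, admissible version**: `dim A = 5`, `φ ≫ φ = -d` (`d > 0`), `finrank_ℚ End⁰(A) = 2`, multiplicity
`2` or `3` at `i√d`: for every admissible `𝔤` and any `ψ`, every `(φ^*)_ℂ`-commuting `ψ_ℂ`-skew operator lies in `spanC 𝔤` — the
shape in which TABLE X row 17 (`E_k × Y₅^{(3,2)}`) feeds its factor `Y₅` to the product brick.
[cite: MoonenZarhin1999LowDim, §2 (2.4) and Thm. (2.7)] [cite: Ribet1983, Thm. 3] -/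
theorem mem_spanC_twoThree_of_dim_eq_five (hA5 : A.dim = 5) (φ : A ⟶ A) {d : ℕ} (hd : 0 < d)
    (hφ : φ ≫ φ = -(d • 𝟙 A)) (hE2 : Module.finrank ℚ A.endAlgebra = 2)
    (h23 : eigenMultiplicity A φ (Complex.I * (Real.sqrt d : ℂ)) = 2 ∨
      eigenMultiplicity A φ (Complex.I * (Real.sqrt d : ℂ)) = 3)
    (hHD : exists_isReal_hodgeModel) (hI : hodgePQ_independent_of_hodgeModel)
    (ψ : (BettiUniverse.hodge hHD (AbelianVariety.isSmoothProjective_holds (A := A)) 1).Polarization)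
    (𝔤 : Submodule ℚ (Module.End ℚ (bettiCohomology A.X 1))) (hbr : ∀ X ∈ 𝔤, ∀ X' ∈ 𝔤, X * X' - X' * X ∈ 𝔤)
    {Θ : Module.End ℂ (ℂ ⊗[ℚ] bettiCohomology A.X 1)}
    (hΘ : ∀ p : ℤ, ∀ x ∈ (BettiUniverse.hodge hHD (AbelianVariety.isSmoothProjective_holds (A := A)) 1).piece p (1 - p),
      Θ x = ((2 * p - 1 : ℤ) : ℂ) • x)
    (hΘ𝔤 : Θ ∈ spanC 𝔤)
    (hcomm : ∀ X ∈ 𝔤, ∀ a : (BettiUniverse.hodge hHD (AbelianVariety.isSmoothProjective_holds (A := A)) 1).endAlg,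
      X * (a : Module.End ℚ (bettiCohomology A.X 1)) = (a : Module.End ℚ (bettiCohomology A.X 1)) * X)
    (hskew : ∀ X ∈ 𝔤, ∀ v w, ψ.form (X v) w + ψ.form v (X w) = 0) :
    ∀ Y : Module.End ℂ (ℂ ⊗[ℚ] bettiCohomology A.X 1),
      Y * ((bettiCohomology.map φ.hom.hom.hom 1).hom).baseChange ℂ =
          ((bettiCohomology.map φ.hom.hom.hom 1).hom).baseChange ℂ * Y →
        (∀ x y, ψ.form.baseChange ℂ (Y x) y + ψ.form.baseChange ℂ x (Y y) = 0) → Y ∈ spanC 𝔤 := by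
  have hsum := eigenMultiplicity_add_eigenMultiplicity_neg_eq_dim A φ hd hφ
  refine mem_spanC_twoThree_of_eigenMultiplicity φ hd hφ hE2 ?_ hHD hI ψ 𝔤 hbr hΘ hΘ𝔤 hcomm hskew
  rcases h23 with h2 | h3
  · exact Or.inr ⟨h2, by omega⟩
  · exact Or.inl ⟨h3, by omega⟩

end Literature.AlgebraicGeometry.HodgeTheory

end
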